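import Summits.QuantumFields.YangMills.Theorems.UnitScaleTiltFluctuationComparisonRegPrLiftLegsLoops
import Summits.QuantumFields.YangMills.Theorems.UnitScaleTiltFluctuationComparisonRegPrLiftFaceAvg
import Literature.MathematicalPhysics.QuantumFieldTheory.Balaban1983to89.BlockAveragingEMLLinearised

/-!
# Route `UnitScaleTilt` — crux K1bR-pr `FluctuationComparisonRegPr` (stmt-QuantumFields-19201 → `…L`), stub `stub_oneStepSmallLift`, piece (L2)
# for INTERIOR-SUPPORTED corrections — the Γ-LEG LAYER, file 2: THE (0.4) BLOCK AVERAGE OF `U⋆ = E · faceSec V` TO SECOND ORDER FOR AN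
# ARBITRARY CORRECTION `E` (support file `--supports stmt-QuantumFields-19201`)

Cell `ym3-torus` (HUMAN RULING D-0037, YM ladder rung R3), seat `ym3-torus-p1` gen 11 (UV side; cell memo HOME/UV3-NODE.md §20).  File 1
(`…LiftLegsLoops`) factorised the OPEN loop transporters of `U⋆ = E · faceSec V` exactly: `openLoop U⋆ c (r,σ,σ′) = E(in-walk) · V(c) · E(out-walk)`,
the in-walk (`inWord`: staircase `Γ^σ` of `B(c₋)` then the row up to its exit bond) lying in `B(c₋)` and the out-walk (`outWord`: the rest of the
row, then `Γ^{σ′}` of `B(c₊)` backwards) in `B(c₊)`.  Here, for `SU(N)` and the printed inner operation `exp[mean log]`: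

* §1 **`norm_avgFun_sub_mean_openLoop_le`** (ANY fine configuration `U` whose (0.4) loop variables at `c` are within `t ≤ 1/10`, `t < δ_N`, of `1`):
  `‖Ū(c) − |I|⁻¹ Σ_i openLoop U c i‖ ≤ 7t²` — TO SECOND ORDER BAŁABAN'S (0.4) AVERAGE IS THE ARITHMETIC MEAN OF THE OPEN LOOP TRANSPORTERS
  (p1 g8's `coe_corr_eq_eml` + `norm_eml_sub_one_sub_mean_le`; the factor `U(c)⁻¹` of the loops cancels against the straight transporter EXACTLY).
* §2 `norm_walkSum_le`; the loop variables of `U⋆` are within `8ms` of `1` (`dist1_loopHol_mulField_faceSec_le'`, `m = (d+3)L` bounds the lengths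
  of the in- and out-walks and rows, `length_inWalk_le` / `length_outWalk_le`).
* §3 the first-order functionals **`inLin E c`** `= |I|⁻¹ Σ_i Y_E(in-walk_i)` (frame `c₋`) and **`outLin E c`** `= |I|⁻¹ Σ_i Y_E(out-walk_i)` (frame `c₊`),
  `Y_E = E − 1` summed with signs along the walks (`BlockAveragingEMLLinearised.walkSum`), and the HEAD THEOREM
  **`norm_avgFun_mulField_faceSec_sub_legs_le`**: if every `dist1 (E b) ≤ s` with `80ms ≤ 1` and `8ms < δ_N`, then for every coarse bond `c`
  `‖Ū⋆(c) − (V(c) + inLin E c · V(c) + V(c) · outLin E c)‖ ≤ 458 (ms)²`.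
  For an EXIT-supported `E` this is F2 (`inLin = L^{-d}Σ_r (E(exitBond c r) − 1)`, `outLin = 0`); for an interior-supported kernel the in- and out-
  functionals split (file 3) into a COARSE GAUGE part (the staircase functional of each block, removable by `approxLiftStep_of_gauge`) and a
  LINE part (the generalised S-neutrality functional the kernel must annihilate).

Inputs by name: `BlockAveragingEMLLinearised.norm_holAt_sub_one(_sub_walkSum)_le_of_length_le` ([Balaban1985Averaging] (122)–(123) for (0.4),
ym-ust-19200-p2), file 1, F2's constants.  Elementary; nothing of Bałaban's is asserted.
-/

noncomputable section

open scoped BigOperators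

namespace Summit.QuantumFields.YangMills.Theorems.ApproxLift

open Literature.MathematicalPhysics.QuantumFieldTheory.Balaban1983to89
open T4Continuum BlockAveraging AveragingRT B10Eq47AxialChi BlockAveragingSection BlockAveragingSectionPlaq
open NormedSpace ExpMeanLog
open scoped Matrix.Norms.L2Operator
open Summit.QuantumFields.YangMills.Theorems.AvgActionDefect (coe_corr_eq_eml norm_eml_sub_one_sub_mean_le norm_mean_le holAt_walk_replicate)
open BlockAveragingEMLLinearised (walkSum walkSum_cons length_walk length_walk_stairWord_le norm_holAt_sub_one_le_of_length_le
  norm_holAt_sub_one_sub_walkSum_le_of_length_le)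

variable {P : Params} {j : ℕ}
variable {n : Type*} [Fintype n] [DecidableEq n] [Nonempty n]

/-- In the model, `dist1 g = ‖g − 1‖` (operator norm). -/
private theorem dist1_su_eq₃ (g : Matrix.specialUnitaryGroup n ℂ) : dist1 g = ‖(g : Matrix n n ℂ) - 1‖ := rfl

/-- A special unitary matrix has operator norm `≤ 1`. -/
private theorem norm_coe_su_le_one₃ (g : Matrix.specialUnitaryGroup n ℂ) : ‖(g : Matrix n n ℂ)‖ ≤ 1 :=
  (UnitaryModel.norm_of_mem_unitaryGroup (Matrix.specialUnitaryGroup_le_unitaryGroup g.2)).le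

/-! ## §1 To second order the (0.4) average is the mean of the open loop transporters -/

/-- **`‖Ū(c) − |I|⁻¹ Σ_i openLoop U c i‖ ≤ 7t²`** for ANY fine configuration whose (0.4) loop variables at `c` are within `t` of `1`
(`t ≤ 1/10`, `t < δ_N`): `Ū(c) = exp[mean log W_i] · U(c)` with `exp[mean log W_i] = 1 + mean(W_i − 1) + O(t²)` and
`(1 + mean(W_i − 1)) · U(c) = mean(W_i · U(c)) = mean(openLoop_i)`. -/
theorem norm_avgFun_sub_mean_openLoop_le {U : GaugeField P j (Matrix.specialUnitaryGroup n ℂ)} {c : PBond P (j + 1)} {t : ℝ}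
    (hW : ∀ i, dist1 (loopHol U c i) ≤ t) (ht : t ≤ 1 / 10) (hδ : t < deltaSU n) :
    ‖((avgFun (expMeanLogSU (n := n)) U c : Matrix.specialUnitaryGroup n ℂ) : Matrix n n ℂ) -
        ((Fintype.card (Idx P) : ℂ))⁻¹ • ∑ i : Idx P, ((openLoop U c i : Matrix.specialUnitaryGroup n ℂ) : Matrix n n ℂ)‖ ≤ 7 * t ^ 2 := by
  have hcorr := coe_corr_eq_eml (n := n) (U := U) (c := c) fun i => (hW i).trans_lt hδ
  have hW' : ∀ i, ‖((loopHol U c i : Matrix.specialUnitaryGroup n ℂ) : Matrix n n ℂ) - 1‖ ≤ t := fun i => by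
    rw [← dist1_su_eq₃]; exact hW i
  have heml := norm_eml_sub_one_sub_mean_le hW' ht
  set A : Matrix n n ℂ := ((axialAvg U c : Matrix.specialUnitaryGroup n ℂ) : Matrix n n ℂ) with hA
  set C : Matrix n n ℂ := ((corr (expMeanLogSU (n := n)) U c : Matrix.specialUnitaryGroup n ℂ) : Matrix n n ℂ) with hC
  set M : Matrix n n ℂ := ((Fintype.card (Idx P) : ℂ))⁻¹ •
    ∑ i : Idx P, (((loopHol U c i : Matrix.specialUnitaryGroup n ℂ) : Matrix n n ℂ) - 1) with hM
  have hcard : (Fintype.card (Idx P) : ℂ) ≠ 0 := by exact_mod_cast Fintype.card_ne_zero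
  have havg : ((avgFun (expMeanLogSU (n := n)) U c : Matrix.specialUnitaryGroup n ℂ) : Matrix n n ℂ) = C * A := by
    show (((corr (expMeanLogSU (n := n)) U c * axialAvg U c : Matrix.specialUnitaryGroup n ℂ)) : Matrix n n ℂ) = _
    rw [Submonoid.coe_mul]
  -- `mean(openLoop_i) = M · A + A`
  have hopen : ∀ i : Idx P, ((openLoop U c i : Matrix.specialUnitaryGroup n ℂ) : Matrix n n ℂ) =
      (((loopHol U c i : Matrix.specialUnitaryGroup n ℂ) : Matrix n n ℂ) - 1) * A + A := fun i => by
    rw [openLoop, Submonoid.coe_mul, sub_mul, one_mul, sub_add_cancel]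
  have hmean : ((Fintype.card (Idx P) : ℂ))⁻¹ • ∑ i : Idx P, ((openLoop U c i : Matrix.specialUnitaryGroup n ℂ) : Matrix n n ℂ) =
      M * A + A := by
    simp_rw [hopen]
    rw [Finset.sum_add_distrib, smul_add, ← Finset.sum_mul, ← smul_mul_assoc, Finset.sum_const, Finset.card_univ,
      ← Nat.cast_smul_eq_nsmul ℂ, smul_smul, inv_mul_cancel₀ hcard, one_smul]
  have hkey : C * A - (M * A + A) = (C - 1 - M) * A := by noncomm_ring
  rw [havg, hmean, hkey]
  calc ‖(C - 1 - M) * A‖ ≤ ‖C - 1 - M‖ * ‖A‖ := norm_mul_le _ _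
    _ ≤ 7 * t ^ 2 * 1 := by
        refine mul_le_mul ?_ (norm_coe_su_le_one₃ _) (norm_nonneg _) (by positivity)
        rw [hcorr]
        exact heml
    _ = 7 * t ^ 2 := mul_one _

/-! ## §2 Sizes: signed sums along walks, the legs, the loop variables of `U⋆` -/

/-- The correction as a matrix-valued bond field `Y_E(b) = E(b) − 1`. -/
def corrY (E : GaugeField P j (Matrix.specialUnitaryGroup n ℂ)) : PBond P j → Matrix n n ℂ :=
  fun b => ((E b : Matrix.specialUnitaryGroup n ℂ) : Matrix n n ℂ) - 1

/-- `‖Y(Γ)‖ ≤ |Γ|·s` when every `‖Y_b‖ ≤ s`. -/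
theorem norm_walkSum_le {V : Type*} [SeminormedAddCommGroup V] (Y : PBond P j → V) {s : ℝ} (hY : ∀ b, ‖Y b‖ ≤ s) :
    ∀ γ : List (LStep P j), ‖walkSum Y γ‖ ≤ γ.length * s
  | [] => by simp [walkSum]
  | st :: γ => by
    rw [walkSum_cons, List.length_cons, Nat.cast_succ, add_mul, one_mul, add_comm ((γ.length : ℝ) * s)]
    refine (norm_add_le _ _).trans (add_le_add ?_ (norm_walkSum_le Y hY γ))
    split_ifs
    · exact hY _
    · rw [norm_neg]; exact hY _

/-- THE LENGTH BUDGET `m = (d+3)L` of the in- and out-walks. -/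
def legLen (P : Params) : ℕ := (P.d + 3) * P.L

/-- `|in-walk| ≤ m`. -/
theorem length_inWalk_le (c : PBond P (j + 1)) (r : Fin P.d → Fin P.L) (σ : Equiv.Perm (Fin P.d)) :
    (walk (emb c.src) (inWord c r σ)).length ≤ legLen P := by
  rw [length_walk, length_inWord]
  have h1 := length_walk_stairWord_le (emb c.src) σ r
  rw [length_walk] at h1
  have h2 : P.L - (r c.dir : ℕ) ≤ P.L := Nat.sub_le _ _
  have h3 : legLen P = (P.d + 2) * P.L + P.L := by unfold legLen; ring
  omega

/-- `|out-walk| ≤ m`. -/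
theorem length_outWalk_le (c : PBond P (j + 1)) (r : Fin P.d → Fin P.L) (σ' : Equiv.Perm (Fin P.d)) :
    (walk (outBase c r) (outWord c r σ')).length ≤ legLen P := by
  rw [length_walk, length_outWord]
  have h1 := length_walk_stairWord_le (emb c.tgt) σ' r
  rw [length_walk] at h1
  have h2 : (r c.dir : ℕ) ≤ P.L := (r c.dir).isLt.le
  have h3 : legLen P = (P.d + 2) * P.L + P.L := by unfold legLen; ring
  omega

/-- A row of `k ≤ L` bonds has at most `m` steps. -/
theorem length_rowWalk_le (x : Site P j) (μ : Fin P.d) {k : ℕ} (hk : k ≤ P.L) :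
    (walk x (List.replicate k (μ, true))).length ≤ legLen P := by
  rw [length_walk, List.length_replicate]
  have h3 : P.L ≤ legLen P := by unfold legLen; exact Nat.le_mul_of_pos_left _ (by omega)
  omega

variable {E : GaugeField P j (Matrix.specialUnitaryGroup n ℂ)} {s : ℝ}

/-- `dist1 (E b) ≤ s` read in the matrix model. -/
theorem norm_corrY_le (hE : ∀ b, dist1 (E b) ≤ s) (b : PBond P j) : ‖corrY E b‖ ≤ s := hE b

/-- A holonomy of `E` along at most `m` steps is within `2ms` of `1` (`ms ≤ 1/2`). -/
theorem dist1_holAt_le_of_length_le (s0 : 0 ≤ s) (hE : ∀ b, dist1 (E b) ≤ s) (hms : (legLen P : ℝ) * s ≤ 1 / 2)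
    (γ : List (LStep P j)) (hγ : γ.length ≤ legLen P) : dist1 (holAt E γ) ≤ 2 * (legLen P) * s := by
  rw [dist1_su_eq₃]
  exact norm_holAt_sub_one_le_of_length_le E s0 (fun b => by rw [← dist1_su_eq₃]; exact hE b) hms γ hγ

/-- **THE (0.4) LOOP VARIABLES OF `U⋆ = E · faceSec V` ARE WITHIN `8ms` OF `1`** for an arbitrary correction with `dist1 (E b) ≤ s`, `ms ≤ 1/2`:
`W_c(i) = legIn · V(c) · legOut · (A_in · V(c) · A_out)⁻¹`, four factors within `2ms` each (conjugation by `V(c)` is isometric). -/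
theorem dist1_loopHol_mulField_faceSec_le' (hj : j + 1 ≤ P.m + P.K) (hE : ∀ b, dist1 (E b) ≤ s) (hms : (legLen P : ℝ) * s ≤ 1 / 2)
    (V : GaugeField P (j + 1) (Matrix.specialUnitaryGroup n ℂ)) (c : PBond P (j + 1)) (i : Idx P) :
    dist1 (loopHol (mulField E (faceSec V)) c i) ≤ 8 * (legLen P) * s := by
  have s0 : 0 ≤ s := (GaugeGroup.dist1_nonneg _).trans (hE ⟨emb c.src, c.dir⟩)
  obtain ⟨r, σ, σ'⟩ := i
  rw [loopHol_eq_openLoop_mul, openLoop_mulField_faceSec_eq_holAt hj, axialAvg_mulField_faceSec_split' hj]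
  -- the four near-identity factors
  set Iin := holAt E (walk (emb c.src) (inWord c r σ)) with hIin
  set Iout := holAt E (walk (outBase c r) (outWord c r σ')) with hIout
  set Ain := rowProd E (Site.blockSite c.src (ctr P)) c.dir (P.L - (ctr P c.dir : ℕ)) with hAin
  set Aout := rowProd E (shiftN (Site.blockSite c.src (ctr P)) c.dir (P.L - (ctr P c.dir : ℕ))) c.dir (ctr P c.dir : ℕ) with hAout
  have h1 : dist1 Iin ≤ 2 * (legLen P) * s := dist1_holAt_le_of_length_le s0 hE hms _ (length_inWalk_le c r σ)
  have h2 : dist1 Iout ≤ 2 * (legLen P) * s := dist1_holAt_le_of_length_le s0 hE hms _ (length_outWalk_le c r σ')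
  have h3 : dist1 Ain ≤ 2 * (legLen P) * s := by
    rw [hAin, ← holAt_walk_replicate]
    exact dist1_holAt_le_of_length_le s0 hE hms _ (length_rowWalk_le _ _ (Nat.sub_le _ _))
  have h4 : dist1 Aout ≤ 2 * (legLen P) * s := by
    rw [hAout, ← holAt_walk_replicate]
    exact dist1_holAt_le_of_length_le s0 hE hms _ (length_rowWalk_le _ _ (ctr P c.dir).isLt.le)
  have hW : Iin * V c * Iout * (Ain * V c * Aout)⁻¹ = Iin * (V c * (Iout * Aout⁻¹) * (V c)⁻¹) * Ain⁻¹ := by group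
  rw [hW]
  have h24 : dist1 (Iout * Aout⁻¹) ≤ 2 * (legLen P) * s + 2 * (legLen P) * s :=
    (GaugeGroup.dist1_mul_le _ _).trans (by rw [GaugeGroup.dist1_inv]; exact add_le_add h2 h4)
  calc dist1 (Iin * (V c * (Iout * Aout⁻¹) * (V c)⁻¹) * Ain⁻¹)
      ≤ dist1 Iin + dist1 (V c * (Iout * Aout⁻¹) * (V c)⁻¹) + dist1 Ain⁻¹ :=
        (GaugeGroup.dist1_mul_le _ _).trans (add_le_add (GaugeGroup.dist1_mul_le _ _) le_rfl)
    _ = dist1 Iin + dist1 (Iout * Aout⁻¹) + dist1 Ain := by rw [GaugeGroup.dist1_conj, GaugeGroup.dist1_inv]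
    _ ≤ 2 * (legLen P) * s + (2 * (legLen P) * s + 2 * (legLen P) * s) + 2 * (legLen P) * s :=
        add_le_add (add_le_add h1 h24) h3
    _ = 8 * (legLen P) * s := by ring

/-! ## §3 The first-order functionals of the legs and the head theorem -/

/-- **THE IN-LEG FUNCTIONAL** (frame `c₋`): the mean over the index set of the signed sums of `Y_E = E − 1` along the in-walks (staircase of `B(c₋)` to
`x_r`, then the row up to and including its exit bond). -/
def inLin (E : GaugeField P j (Matrix.specialUnitaryGroup n ℂ)) (c : PBond P (j + 1)) : Matrix n n ℂ :=
  ((Fintype.card (Idx P) : ℂ))⁻¹ • ∑ i : Idx P, walkSum (corrY E) (walk (emb c.src) (inWord c i.1 i.2.1))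

/-- **THE OUT-LEG FUNCTIONAL** (frame `c₊`): the same along the out-walks (the rest of the row inside `B(c₊)`, then the staircase of `B(c₊)`
backwards to its centre). -/
def outLin (E : GaugeField P j (Matrix.specialUnitaryGroup n ℂ)) (c : PBond P (j + 1)) : Matrix n n ℂ :=
  ((Fintype.card (Idx P) : ℂ))⁻¹ • ∑ i : Idx P, walkSum (corrY E) (walk (outBase c i.1) (outWord c i.1 i.2.2))

/-- **THE (0.4) BLOCK AVERAGE OF `U⋆ = E · faceSec V` TO SECOND ORDER, FOR AN ARBITRARY CORRECTION `E`** (`SU(N)`, printed `exp[mean log]`,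
standing range): if every `dist1 (E b) ≤ s` with `80·m·s ≤ 1` and `8·m·s < δ_N` (`m = (d+3)L`), then for every coarse bond `c`
`‖Ū⋆(c) − (V(c) + inLin E c · V(c) + V(c) · outLin E c)‖ ≤ 458·(ms)²`. -/
theorem norm_avgFun_mulField_faceSec_sub_legs_le (hj : j + 1 ≤ P.m + P.K) (hE : ∀ b, dist1 (E b) ≤ s)
    (hsm : 80 * (legLen P : ℝ) * s ≤ 1) (hδ : 8 * (legLen P : ℝ) * s < deltaSU n)
    (V : GaugeField P (j + 1) (Matrix.specialUnitaryGroup n ℂ)) (c : PBond P (j + 1)) :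
    ‖((avgFun (expMeanLogSU (n := n)) (mulField E (faceSec V)) c : Matrix.specialUnitaryGroup n ℂ) : Matrix n n ℂ) -
        ((V c : Matrix n n ℂ) + inLin E c * (V c : Matrix n n ℂ) + (V c : Matrix n n ℂ) * outLin E c)‖ ≤
      458 * ((legLen P : ℝ) * s) ^ 2 := by
  set m : ℝ := (legLen P : ℝ) with hm
  have m0 : 0 ≤ m := Nat.cast_nonneg _
  have s0 : 0 ≤ s := (GaugeGroup.dist1_nonneg _).trans (hE ⟨emb c.src, c.dir⟩)
  have x0 : 0 ≤ m * s := mul_nonneg m0 s0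
  have hms : m * s ≤ 1 / 2 := by nlinarith
  have hY : ∀ b, ‖corrY E b‖ ≤ s := norm_corrY_le hE
  have hEn : ∀ b, ‖((E b : Matrix.specialUnitaryGroup n ℂ) : Matrix n n ℂ) - 1‖ ≤ s := fun b => by
    rw [← dist1_su_eq₃]; exact hE b
  set U : GaugeField P j (Matrix.specialUnitaryGroup n ℂ) := mulField E (faceSec V) with hU
  set Vc : Matrix n n ℂ := ((V c : Matrix.specialUnitaryGroup n ℂ) : Matrix n n ℂ) with hVc
  have hVc1 : ‖Vc‖ ≤ 1 := norm_coe_su_le_one₃ _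
  -- §1 at `t = 8ms`
  have hloops : ∀ i, dist1 (loopHol U c i) ≤ 8 * m * s := fun i => dist1_loopHol_mulField_faceSec_le' hj hE hms V c i
  have h1 := norm_avgFun_sub_mean_openLoop_le (U := U) (c := c) hloops (by nlinarith) hδ
  -- per index: `openLoop_i = I·V·O` with `I = 1 + a + ρ`, `O = 1 + b + ρ′`
  have hper : ∀ i : Idx P,
      ‖((openLoop U c i : Matrix.specialUnitaryGroup n ℂ) : Matrix n n ℂ) -
          (Vc + walkSum (corrY E) (walk (emb c.src) (inWord c i.1 i.2.1)) * Vc +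
            Vc * walkSum (corrY E) (walk (outBase c i.1) (outWord c i.1 i.2.2)))‖ ≤ 10 * (m * s) ^ 2 := by
    rintro ⟨r, σ, σ'⟩
    dsimp only
    set I : Matrix n n ℂ := ((holAt E (walk (emb c.src) (inWord c r σ)) : Matrix.specialUnitaryGroup n ℂ) : Matrix n n ℂ) with hI
    set O : Matrix n n ℂ := ((holAt E (walk (outBase c r) (outWord c r σ')) : Matrix.specialUnitaryGroup n ℂ) : Matrix n n ℂ) with hO
    set a : Matrix n n ℂ := walkSum (corrY E) (walk (emb c.src) (inWord c r σ)) with ha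
    set b : Matrix n n ℂ := walkSum (corrY E) (walk (outBase c r) (outWord c r σ')) with hb
    have hopen : ((openLoop U c (r, σ, σ') : Matrix.specialUnitaryGroup n ℂ) : Matrix n n ℂ) = I * Vc * O := by
      rw [hU, openLoop_mulField_faceSec_eq_holAt hj, Submonoid.coe_mul, Submonoid.coe_mul]
    have hρ : ‖I - 1 - a‖ ≤ 3 * m ^ 2 * s ^ 2 :=
      norm_holAt_sub_one_sub_walkSum_le_of_length_le E s0 hEn hms _ (length_inWalk_le c r σ)
    have hρ' : ‖O - 1 - b‖ ≤ 3 * m ^ 2 * s ^ 2 :=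
      norm_holAt_sub_one_sub_walkSum_le_of_length_le E s0 hEn hms _ (length_outWalk_le c r σ')
    have haN : ‖a‖ ≤ m * s :=
      (norm_walkSum_le (corrY E) hY _).trans (mul_le_mul_of_nonneg_right (by rw [hm]; exact_mod_cast length_inWalk_le c r σ) s0)
    have hbN : ‖b‖ ≤ m * s :=
      (norm_walkSum_le (corrY E) hY _).trans (mul_le_mul_of_nonneg_right (by rw [hm]; exact_mod_cast length_outWalk_le c r σ') s0)
    have hO1 : ‖O‖ ≤ 1 := norm_coe_su_le_one₃ _
    have key : I * Vc * O - (Vc + a * Vc + Vc * b) = (I - 1 - a) * Vc * O + (1 + a) * Vc * (O - 1 - b) + a * Vc * b := by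
      noncomm_ring
    rw [hopen, key]
    have e1 : ‖(I - 1 - a) * Vc * O‖ ≤ 3 * m ^ 2 * s ^ 2 := by
      calc _ ≤ ‖I - 1 - a‖ * ‖Vc‖ * ‖O‖ := (norm_mul_le _ _).trans (mul_le_mul_of_nonneg_right (norm_mul_le _ _) (norm_nonneg _))
        _ ≤ 3 * m ^ 2 * s ^ 2 * 1 * 1 := by gcongr
        _ = 3 * m ^ 2 * s ^ 2 := by ring
    have e2 : ‖(1 + a) * Vc * (O - 1 - b)‖ ≤ 2 * (3 * m ^ 2 * s ^ 2) := by
      have h1a : ‖1 + a‖ ≤ 2 := by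
        calc ‖1 + a‖ ≤ ‖(1 : Matrix n n ℂ)‖ + ‖a‖ := norm_add_le _ _
          _ ≤ 1 + m * s := add_le_add (by simp) haN
          _ ≤ 2 := by linarith
      calc _ ≤ ‖1 + a‖ * ‖Vc‖ * ‖O - 1 - b‖ := (norm_mul_le _ _).trans (mul_le_mul_of_nonneg_right (norm_mul_le _ _) (norm_nonneg _))
        _ ≤ 2 * 1 * (3 * m ^ 2 * s ^ 2) := by gcongr
        _ = 2 * (3 * m ^ 2 * s ^ 2) := by ring
    have e3 : ‖a * Vc * b‖ ≤ (m * s) * (m * s) := by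
      calc _ ≤ ‖a‖ * ‖Vc‖ * ‖b‖ := (norm_mul_le _ _).trans (mul_le_mul_of_nonneg_right (norm_mul_le _ _) (norm_nonneg _))
        _ ≤ (m * s) * 1 * (m * s) := by gcongr
        _ = (m * s) * (m * s) := by ring
    calc _ ≤ ‖(I - 1 - a) * Vc * O‖ + ‖(1 + a) * Vc * (O - 1 - b)‖ + ‖a * Vc * b‖ := norm_add₃_le
      _ ≤ 3 * m ^ 2 * s ^ 2 + 2 * (3 * m ^ 2 * s ^ 2) + (m * s) * (m * s) := by gcongr
      _ = 10 * (m * s) ^ 2 := by ring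
  -- the mean of the affine terms
  have hcard : (Fintype.card (Idx P) : ℂ) ≠ 0 := by exact_mod_cast Fintype.card_ne_zero
  have haffine : ((Fintype.card (Idx P) : ℂ))⁻¹ • ∑ i : Idx P,
      (Vc + walkSum (corrY E) (walk (emb c.src) (inWord c i.1 i.2.1)) * Vc +
        Vc * walkSum (corrY E) (walk (outBase c i.1) (outWord c i.1 i.2.2))) =
      Vc + inLin E c * Vc + Vc * outLin E c := by
    rw [Finset.sum_add_distrib, Finset.sum_add_distrib, smul_add, smul_add, Finset.sum_const, Finset.card_univ,
      ← Nat.cast_smul_eq_nsmul ℂ, smul_smul, inv_mul_cancel₀ hcard, one_smul, ← Finset.sum_mul, ← smul_mul_assoc,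
      ← Finset.mul_sum, ← mul_smul_comm]
    rfl
  have h2 : ‖((Fintype.card (Idx P) : ℂ))⁻¹ • ∑ i : Idx P, ((openLoop U c i : Matrix.specialUnitaryGroup n ℂ) : Matrix n n ℂ) -
      (Vc + inLin E c * Vc + Vc * outLin E c)‖ ≤ 10 * (m * s) ^ 2 := by
    rw [← haffine, ← smul_sub, ← Finset.sum_sub_distrib]
    exact norm_mean_le (fun i => hper i) (by positivity)
  calc _ ≤ ‖((avgFun (expMeanLogSU (n := n)) U c : Matrix.specialUnitaryGroup n ℂ) : Matrix n n ℂ) -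
          ((Fintype.card (Idx P) : ℂ))⁻¹ • ∑ i : Idx P, ((openLoop U c i : Matrix.specialUnitaryGroup n ℂ) : Matrix n n ℂ)‖ +
        ‖((Fintype.card (Idx P) : ℂ))⁻¹ • ∑ i : Idx P, ((openLoop U c i : Matrix.specialUnitaryGroup n ℂ) : Matrix n n ℂ) -
          (Vc + inLin E c * Vc + Vc * outLin E c)‖ := norm_sub_le_norm_sub_add_norm_sub _ _ _
    _ ≤ 7 * (8 * m * s) ^ 2 + 10 * (m * s) ^ 2 := add_le_add h1 h2
    _ = 458 * (m * s) ^ 2 := by ring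

end Summit.QuantumFields.YangMills.Theorems.ApproxLift

end
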